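import Literature.AnabelianGeometry.SemiGraphs.TemperedReconstructionReductions
import Literature.AnabelianGeometry.SemiGraphs.TemperedFunctorialityHomProofs

/-!
# [SemiAnbd] Corollary 3.9, step (R1): an induced homomorphism is compatible with the verticial and
# edge homomorphisms — DISCHARGED

Mochizuki, *Semi-graphs of anabelioids*, Publ. RIMS **42** (2006), §3, Proposition 3.6 (iv) p. 39,
Theorem 3.7 (i)/(iii) pp. 40–41, proof of Corollary 3.9 pp. 42–43
[cite: MochizukiSemiAnbd2006, Prop 3.6(iv) p.39].  The residual named fact `InducesCompatible` (R1) of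
`TemperedReconstructionReductions.lean` (abc-iut-L3-t2): if `φ : π₁^temp(G) → π₁^temp(H)` is induced
by a morphism `F : G → H` — `B^temp(φ) ≅ c_H⁻¹ ⋙ F^* ⋙ c_G` through charts, `Hom.Induces` — then
`φ` is compatible, up to `π₁^temp(H)`-conjugation, with the verticial homomorphisms (`Hom.CompatV`)
and with the edge homomorphisms (`Hom.CompatE`).  This is exactly abc-iut-L3-t10's
`Hom.conj_of_chartPullback_iso` and its edge analogue `Hom.conj_of_chartPullback_iso_edge`
(`TemperedFunctorialityHomProofs.lean`: restrict the isomorphism of pull-back functors to a vertex /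
an edge and apply Proposition 3.2, `BTemp.exists_conj_of_natTrans`); the hypotheses
`Cor39Hypotheses` of the named fact are not needed for this step.  Proof-only file.
-/

namespace Literature.AnabelianGeometry.SemiGraphs

namespace ProfiniteSemiGraph

universe u

/-- NAMED FACT `InducesCompatible` (step (R1) of the proof of [SemiAnbd] Cor. 3.9; Prop. 3.6 (iv) /
Thm. 3.7 (i), (iii)) — DISCHARGED: a homomorphism `φ` induced by `F : G → H` through charts
(`F.Induces c_G c_H φ`) is compatible with the verticial and the edge homomorphisms up to
conjugation. [cite: MochizukiSemiAnbd2006, Prop 3.6(iv) p.39] -/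
theorem InducesCompatible_holds : InducesCompatible.{u} := by
  intro 𝒢 ℋ _ _ c𝒢 cℋ F φ hφ
  exact ⟨fun v ψ ψ' hψ hψ' => F.conj_of_chartPullback_iso c𝒢 cℋ φ hφ v ψ ψ' hψ hψ',
    fun e ψ ψ' hψ hψ' => F.conj_of_chartPullback_iso_edge c𝒢 cℋ φ hφ e ψ ψ' hψ hψ'⟩

end ProfiniteSemiGraph

end Literature.AnabelianGeometry.SemiGraphs
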